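import Summits.QuantumFields.BalabanUV.T4Continuum.Support.ShellMeasureExpHaarClosedBallSUN
import Summits.QuantumFields.BalabanUV.T4Continuum.Support.ShellMeasureLevelAssembly

/-!
# `T4Continuum.ShellMeasureRootCompositionSUN` — NE7c ROOT COMPOSITION, END-II FOR `G = SU(N)`, EVERY `N`, WITH NO
# CHART-IDENTITY BINDER: the per-slot anti-concentration (M1) for a REALIZED slot measure
# `(fieldMeasure P j SU(N)).withDensity F` from the LEVEL DATA of every tree-gauged exterior section — the binders
# SM-L1…L6 of the skeleton, displayed — through the tree gauge, the block sections and the exponential chart of `SU(N)`,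
# the one-bond chart identity (CH)₁ being now a THEOREM of the tree
# (cell `pub-balaban`, sub-cell `t4`, spine estimate NE7c (node U5b); ROUND-2 crew `t4-ne7c-formalise-*`, seat
# `b2b-balaban-t4-ne7c-formalise-leaf-08` (gen 7); row S3 «SM-L9 SU(N) chart» of `t4/b2b-balaban-t4-ne7c-p1/LEAVES-NE7c-P1.md`
# (trigger `t4/T4-NE7c-TRIGGER.json`, c5: optional and last — `SU(2)` is the row's certified instance), OFFERED leaf
# «END-II for SU(N), (CH)₁-free» (journal `CLAIMS.log` l.11184); ADDITIVE — imports `ShellMeasureExpHaarClosedBallSUN`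
# ((CH)₁ on `0 ≤ S ≤ π`, p215095) and `ShellMeasureLevelAssembly` (the one-depth assembly A3, p206468) only and modifies
# nothing — in particular the `SU(2)` END-II chain (E2, E2′, the level-0 words and realized-`SU(2)` modules) does NOT
# enter the `SU(N)` road's import cone (its only `SU2`-named member stays `ShellMeasureScalingSU2`, already imported by
# S3 f4 `ShellMeasureExpJacobianSUN`); 0 `def`, 0 sorry, 0 citations, no `def … : Prop`)

HONEST FRAMING.  Finite four-torus programme, rung (B)+1 only — NOT infinite volume, NOT a mass gap, NOT the Clay
problem, NOT summit progress; (B), `BetaPertHyp`, (B^μ) are not mentioned because nothing here consumes them.  The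
cell wall of NE7c — (M1) `T4ShellMeasure.SlotAntiConcentration` FOR BAŁABAN'S INDUCTIVELY DEFINED EFFECTIVE MEASURES —
is NOT PRINTED in [Balaban 1983–89] (GAPS G-ne7cp1-1), asserted by nobody, and NOT moved by this file; NOTHING in the
countdown moves (spine PROVED 0/9); every result below reads «(M1) for the realized `SU(N)` law ⇐ the named binders»,
never «NE7c proved».  [folklore] kernel bookkeeping over tree theorems BY NAME.  HONEST DEPENDENCY (cell): continuum YM
on T⁴ ⇐ BetaPertH ∧ nine spine estimates (0/9 proved); BetaPertH ⇐ (D1) ∧ (D4) ∧ CAP+tail; G-an2-4 gates asym, D1 and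
NE2/3/4.

THE POINT.  For `G = SU(2)` the crew's END-II (`ShellMeasureRootCompositionSU2.slotAC_realized_su2_of_levelData`,
row S7b; dictionary-on-the-cube form E2′ `ShellMeasureRootCompositionLevelZero.slotAC_realized_su2_of_levelData_cube`,
row S11) turns END-I's per-slot binder `hac` — (M1) for the slot's realized measure — into the LEVEL DATA BINDERS per
exterior section (SM-L1 `hAN`, SM-L2 `hSM`, SM-L3 `hGW`, SM-L4 `hE`, SM-L5/L6 `hJW`/`hJ`, dictionary `hRdict`/`hudict`),
using the tree's `SU(2)` cube chart.  Row S3 built the `SU(N)` chart (`ShellMeasureExpChartSUN`), the (CH) reduction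
`ShellMeasureScalingSUN.chart_suN` and the realized ENGINE `ShellMeasureRealizedSUN.slotAntiConcentration_realized_suN_expJac`
with exactly ONE located binder beyond `SU(2)`, the one-bond chart identity (CH)₁ `hCH`; the (CH)₁ line
(`ShellMeasureExpDuhamelSUN`, `…DuhamelHadamardSUN`, `…ExpDuhamelDetSUN`, `…ExpInjectiveSUN`, `…HaarHausdorffSUN`,
`…RegularConeSUN`, … → `ShellMeasureExpHaarAreaSUN.haar_restrict_expBallSU` →
`ShellMeasureExpHaarClosedBallSUN.haar_restrict_expBallSU_le`) has since made (CH)₁ a THEOREM for every `N` and every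
window radius `0 ≤ S ≤ π`.  This file closes the `SU(N)` road at
the LEVEL-DATA end: END-II for `SU(N)` with the binder list of E2′ TOKEN FOR TOKEN (types), `SU2 ↦ SUN N`,
`Fin n → ℝ ↦ BlockChartSU N Λ` (one Euclidean coordinate vector per bond), `cube n S ↦ closedBall 0 S`,
`expFibreChart Λ (c V) e ↦ expFibreChartSU Λ (c V)`, `expWindowDensity ↦ windowSU`, `3S² < π² ↦ S ≤ π`, and NO `hCH`,
`hJ₁`, `hJ₁c` binder; constant `2(#Λ·d_N + β Σ_p L̄_p(d̄_p + 4s̄_p) + B_𝓔)/(1−δ)`, `d_N = dimSU N = dim 𝔰𝔲(N)`.  The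
conclusion IS the per-slot `hac` binder shape of END-I realized along the cutoff-indexed lattice family for ANY gauge
group (`ShellMeasureRootCompositionSeamTower.shellWeightBound_of_towerData` at `G := SUN N`), so that «NE7c ⇐ the named
binders» holds in kernel for every `SU(N)` exactly as for `SU(2)`.

## What is proved ([folklore] bookkeeping; nothing PRINTED is asserted, no binder instantiated)

* §0 two transports of (M1): `slotAntiConcentration_congr_ae` — (M1) sees the tested variable only up to a `μ`-null
  set; `ae_eq_of_eqOn_offNull` — under a density vanishing off a measurable `K`, functions agreeing on `K` agree a.e.
  (together = E2′'s `ShellMeasureRootCompositionLevelZero.slotAntiConcentration_congr_offNull`, re-derived in a.e. form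
  so that the `SU(N)` road does not import the `SU(2)` END-II chain).
* §1 `slotAC_realized_suN_of_chartAC`: realized (M1) for `(fieldMeasure P j SU(N)).withDensity F` from a CHART-LEVEL
  (M1) per exterior section on the block chart space (window factorisation `hFw` through `windowSU`, chart weight
  `chartWeightSU Λ S (expJacWeightSU (kappaSU N))`, chart identity `chart_suN` fed by the THEOREM
  `haar_restrict_expBallSU_le`); `slotAC_realized_suN_of_chartAC_gauge`: the same for a gauge-invariant pair through
  the tree gauge (`T` loop-free, any `U₀`; `ShellMeasureScalingLocal.slotAntiConcentration_gaugeFixed_iff`).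
* §2 END-II for `SU(N)`: `slotAC_realized_suN_of_levelData_ball_raw` — realized (M1) with constant
  `2(#Λ·d_N + β Σ_p L̄_p(d̄_p + 4s̄_p) + B_𝓔)/(1−δ)` from the level data binders of every RAW exterior section (any
  measurable `F`, `u`; the shape of `ShellMeasureWindowFixedCentre.slotAC_realized_su2_of_levelData_raw`), the
  dictionary asked on the chart ball `‖x‖ ≤ S` only (the support of the chart law; §0), via the one-depth assembly
  `ShellMeasureLevelAssembly.slotAntiConcentration_of_levelData` on `BlockChartSU N Λ`; and
  `slotAC_realized_suN_of_levelData_ball` — the same for a gauge-invariant pair read on the TREE-GAUGED sections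
  (E2′'s literal shape), a corollary through the tree gauge.

WHAT THIS DOES NOT DO.  No instance of SM-L1…L6 for Bałaban's localized minimisers / block weights at any live level
(the wall); (LR)_j's window shape for `SU(N)` is the bondwise image window `windowSU` (a MODEL, as `expWindowDensity` is
for `SU(2)`); (Det), (FI-sat), (MR), (W1), the (F∞)-rate keep their status.  NE7c NOT proved.
-/

noncomputable section

open NormedSpace Set Function MeasureTheory Metric

namespace Summit.QuantumFields.BalabanUV.T4Continuum.ShellMeasureRootCompositionSUN

open scoped ENNReal
open Literature.MathematicalPhysics.QuantumFieldTheory.Balaban1983to89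
open GaugeField (GaugeInvariant)
open T4ShellMeasure (SlotAntiConcentration)
open T4ShellMeasureDet (blockLaw slotAntiConcentration_of_chart slotAntiConcentration_realized_of_sections
  measurable_section)
open T4TreeGaugeFixing (NoClosedLoop fixTo measurable_fixTo)
open ShellMeasureScalingLocal (slotAntiConcentration_gaugeFixed_iff)
open ShellMeasureExpChartSUN
open ShellMeasureScalingSUN (windowSU measurable_windowSU chart_suN chartLaw_univ_eq chartWeightSU_le_smul_of_pos)
open ShellMeasureExpJacobianSUN (expJacWeightSU measurable_expJacWeightSU expJacWeightSU_le_smul)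
open ShellMeasureExpHaarAreaSUN (kappaSU)
open ShellMeasureExpHaarClosedBallSUN (haar_restrict_expBallSU_le)
open ShellMeasureWilsonTrace (TraceData)
open ShellMeasureWilsonMoving (MLetter mwordEval mdFro sSum lSum)
open ShellMeasureLevelAssembly (classifier weight slotAntiConcentration_of_levelData)

/-! ## §0 Two transports of (M1): a.e.-equal tested variables; densities vanishing off a set -/

/-- **(M1) SEES THE TESTED VARIABLE ONLY UP TO A NULL SET.**  If `u = u'` almost everywhere for `μ`, (M1) for `u'`
gives (M1) for `u` (same `θ, ρ, D`): the shells `{θ(1−ρ) ≤ u < θ}` and `{θ(1−ρ) ≤ u' < θ}` agree `μ`-a.e.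
[folklore] -/
theorem slotAntiConcentration_congr_ae {Ω : Type*} [MeasurableSpace Ω] {μ : Measure Ω} {u u' : Ω → ℝ}
    (huu' : u =ᵐ[μ] u') {θ ρ D : ℝ} (h : SlotAntiConcentration μ u' θ ρ D) : SlotAntiConcentration μ u θ ρ D := by
  have hae : {x | θ * (1 - ρ) ≤ u x ∧ u x < θ} =ᵐ[μ] {x | θ * (1 - ρ) ≤ u' x ∧ u' x < θ} := by
    filter_upwards [huu'] with x hx
    simp only [eq_iff_iff]
    show x ∈ {x | θ * (1 - ρ) ≤ u x ∧ u x < θ} ↔ x ∈ {x | θ * (1 - ρ) ≤ u' x ∧ u' x < θ}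
    rw [mem_setOf_eq, mem_setOf_eq, hx]
  unfold SlotAntiConcentration at h ⊢
  rw [measure_congr hae]
  exact h

/-- **A DENSITY VANISHING OFF `K` MAKES `Kᶜ` NULL.**  If `f = 0` off a measurable set `K`, two functions agreeing on
`K` agree almost everywhere for `ν.withDensity f` (with `slotAntiConcentration_congr_ae` this is E2′'s
`ShellMeasureRootCompositionLevelZero.slotAntiConcentration_congr_offNull`). [folklore] -/
theorem ae_eq_of_eqOn_offNull {Ω β : Type*} [MeasurableSpace Ω] (ν : Measure Ω) {f : Ω → ℝ≥0∞} {K : Set Ω}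
    (hK : MeasurableSet K) (hf : ∀ x ∉ K, f x = 0) {u u' : Ω → β} (huu' : ∀ x ∈ K, u x = u' x) :
    u =ᵐ[ν.withDensity f] u' := by
  have hnull : ν.withDensity f Kᶜ = 0 := by
    rw [withDensity_apply _ hK.compl, setLIntegral_congr_fun hK.compl (g := fun _ => 0) fun x hx => hf x hx,
      lintegral_zero]
  filter_upwards [(mem_ae_iff.2 hnull : K ∈ ae (ν.withDensity f))] with x hx
  exact huu' x hx

variable {N : ℕ} [NeZero N] {P : Params} {j : ℕ} [DecidableEq (PBond P j)]

/-! ## §1 Realized (M1) from a chart-level (M1) per exterior section — `G = SU(N)`, no chart-identity binder -/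

/-- **REALIZED (M1) FROM CHART-LEVEL (M1), SECTION BY SECTION (`G = SU(N)`).**  Data: chart bonds `Λ` (block chart
space `BlockChartSU N Λ = Λ → ℝ^{d_N}`, `d_N = dimSU N`); window radius `0 ≤ S ≤ π`; per exterior `V` a chart centre
`c V` and a measurable block weight `R V`; the realized density `F` with the window factorisation
`F (V[Λ := y]) = windowSU Λ (c V) S y · R V y` (`hFw`); the tested variable `u`.  If for every exterior `V` the CHART LAW
`volume.withDensity (1_{‖x‖ ≤ S}·∏_b κ_N·expJacSU (x b) · R V ∘ chart)` satisfies (M1) for the variable read in the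
chart, then `(fieldMeasure P j SU(N)).withDensity F` satisfies (M1) for `u`, same constants — the chart identity is
`ShellMeasureScalingSUN.chart_suN` with (CH)₁ SUPPLIED by the theorem
`ShellMeasureExpHaarClosedBallSUN.haar_restrict_expBallSU_le` (no `hCH` binder). [folklore] -/
theorem slotAC_realized_suN_of_chartAC (Λ : Finset (PBond P j)) {S : ℝ} (hS : 0 ≤ S) (hSπ : S ≤ Real.pi)
    (c : GaugeField P j (SUN N) → GaugeField P j (SUN N))
    {R : GaugeField P j (SUN N) → (↥Λ → SUN N) → ℝ≥0∞} (hR : ∀ V, Measurable (R V))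
    {F : GaugeField P j (SUN N) → ℝ≥0∞} (hF : Measurable F)
    (hFw : ∀ V y, F (updateFinset V Λ y) = windowSU Λ (c V) S y * R V y)
    {u : GaugeField P j (SUN N) → ℝ} (hu : Measurable u) {θ ρ D : ℝ}
    (hchart : ∀ V, SlotAntiConcentration
      ((volume : Measure (BlockChartSU N Λ)).withDensity fun x =>
        chartWeightSU Λ S (expJacWeightSU (kappaSU N)) x * R V (expFibreChartSU Λ (c V) x))
      (fun x => u (updateFinset V Λ (expFibreChartSU Λ (c V) x))) θ ρ D) :
    SlotAntiConcentration ((fieldMeasure P j (SUN N)).withDensity F) u θ ρ D := by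
  refine slotAntiConcentration_realized_of_sections Λ hF hu fun V => ?_
  have hsecF : (fun y => F (updateFinset V Λ y)) = fun y => windowSU Λ (c V) S y * R V y := funext (hFw V)
  rw [hsecF]
  exact slotAntiConcentration_of_chart (blockLaw Λ) volume (measurable_expFibreChartSU Λ (c V))
    (measurable_chartWeightSU Λ S (measurable_expJacWeightSU (kappaSU N))) (measurable_windowSU Λ (c V) S)
    (chart_suN Λ (c V) hS (measurable_expJacWeightSU (kappaSU N)) (haar_restrict_expBallSU_le hSπ)) (hR V)
    (measurable_section Λ hu V) (hchart V)

/-- **… FOR A GAUGE-INVARIANT PAIR, THROUGH THE TREE GAUGE (`G = SU(N)`).**  `T` loop-free, any prescribed values `U₀`;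
the window factorisation and the chart-level (M1) are asked of the TREE-GAUGED sections `V ↦ (F ∘ fixTo T U₀)(V[Λ := y])`,
`u ∘ fixTo T U₀` (`ShellMeasureScalingLocal.slotAntiConcentration_gaugeFixed_iff`). [folklore] -/
theorem slotAC_realized_suN_of_chartAC_gauge {T : Finset (PBond P j)} (hT : NoClosedLoop T)
    (U₀ : GaugeField P j (SUN N)) (Λ : Finset (PBond P j)) {S : ℝ} (hS : 0 ≤ S) (hSπ : S ≤ Real.pi)
    (c : GaugeField P j (SUN N) → GaugeField P j (SUN N))
    {R : GaugeField P j (SUN N) → (↥Λ → SUN N) → ℝ≥0∞} (hR : ∀ V, Measurable (R V))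
    {F : GaugeField P j (SUN N) → ℝ≥0∞} (hF : Measurable F) (hFi : GaugeInvariant F)
    (hFw : ∀ V y, F (fixTo T U₀ (updateFinset V Λ y)) = windowSU Λ (c V) S y * R V y)
    {u : GaugeField P j (SUN N) → ℝ} (hu : Measurable u) (hui : GaugeInvariant u) {θ ρ D : ℝ}
    (hchart : ∀ V, SlotAntiConcentration
      ((volume : Measure (BlockChartSU N Λ)).withDensity fun x =>
        chartWeightSU Λ S (expJacWeightSU (kappaSU N)) x * R V (expFibreChartSU Λ (c V) x))
      (fun x => u (fixTo T U₀ (updateFinset V Λ (expFibreChartSU Λ (c V) x)))) θ ρ D) :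
    SlotAntiConcentration ((fieldMeasure P j (SUN N)).withDensity F) u θ ρ D :=
  (slotAntiConcentration_gaugeFixed_iff hT U₀ hF hFi hu hui).1
    (slotAC_realized_suN_of_chartAC Λ hS hSπ c hR (hF.comp (measurable_fixTo T U₀)) hFw
      (hu.comp (measurable_fixTo T U₀)) hchart)

/-! ## §2 END-II for `G = SU(N)`: realized (M1) from the LEVEL DATA of every exterior section -/

section EndTwo

variable {A : Type*} [NormedRing A] [NormedAlgebra ℂ A] [CompleteSpace A] [NormOneClass A]

/-- **END-II FOR `G = SU(N)` ON RAW SECTIONS — REALIZED (M1) ⇐ SM-L1…L6 + DICTIONARY ON THE CHART BALL, PER SLOT,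
EVERY `N`.**  Word for word E2′ `ShellMeasureRootCompositionLevelZero.slotAC_realized_su2_of_levelData_cube` in its
RAW form (`ShellMeasureWindowFixedCentre.slotAC_realized_su2_of_levelData_raw`: no tree-gauge wrapper, ANY measurable
`F` and `u`) with the `SU(N)` chart objects of row S3: data — chart bonds `Λ` (block chart space `BlockChartSU N Λ`,
`#Λ·d_N` real coordinates), window radius `0 ≤ S ≤ π`, per exterior `V` a chart centre `c V` and a measurable block
weight `R V`, a measurable realized density `F` with the window factorisation `hFw` of its RAW sections
`V ↦ F (V[Λ := y])` (window `windowSU Λ (c V) S` = every bond of the block in its image window `c V b · exp(B̄_S)`) and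
per-section finiteness `hfin`, a measurable tested variable `u`; LEVEL DATA per exterior `V`, in a complete normed
`ℂ`-algebra `A` with trace datum `Ttr` (`Ttr.N > 0`): classifier plaquette functionals `hol V p` (`p ∈ P_u ≠ ∅`,
continuous), weight plaquette words `G V p` (`p ∈ P_w`), non-Wilson term `𝓔 V`, window `W V`, kept co-tests `Jco V`;
sizes `s̄ ≤ 1`, `L̄, d̄ ≥ 0`; numbers `θ > 0`, `0 ≤ δ < 1`, `0 ≤ ρ ≤ (1−δ)/2`, `β ≥ 0`, `Rad > 1`, `H`, `B_𝓔 ≥ 0`.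
DICTIONARY, for chart points `‖x‖ ≤ S` ONLY: `hRdict` — on the chart the block weight IS
`Jco V · weight Ttr β P_w (G V) (𝓔 V)`; `hudict` — the tested variable of the section IS `classifier hPu (hol V)`.
BINDERS (the skeleton's estimate leaves, displayed, NOT instantiated; TYPES token-identical with E2′): SM-L5/L6
`hJW`/`hJ`; SM-L1 `hRad`/`hAN`; SM-L3 `hGW`; SM-L4 `hE`/`hB𝓔`; SM-L2 `hSM` (in E2′'s literal
`36·H·1²/(Rad−1)² ≤ δθ` form, typer T-NE7c-2; the clean form follows by `one_pow`/`mul_one`).  NO chart-identity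
binder: (CH)₁ is the theorem `ShellMeasureExpHaarClosedBallSUN.haar_restrict_expBallSU_le`; the Jacobian's
measurability / centre-monotonicity are `ShellMeasureExpJacobianSUN.measurable_expJacWeightSU` /
`expJacWeightSU_le_smul`.
CONCLUSION: `SlotAntiConcentration ((fieldMeasure P j SU(N)).withDensity F) u θ ρ (2(#Λ·d_N + β Σ_p L̄_p(d̄_p + 4s̄_p) + B_𝓔)/(1−δ))`.
CONDITIONAL on every binder; nothing PRINTED is asserted. [folklore] -/
theorem slotAC_realized_suN_of_levelData_ball_raw (Λ : Finset (PBond P j)) {S : ℝ} (hS : 0 ≤ S) (hSπ : S ≤ Real.pi)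
    (c : GaugeField P j (SUN N) → GaugeField P j (SUN N))
    {R : GaugeField P j (SUN N) → (↥Λ → SUN N) → ℝ≥0∞} (hR : ∀ V, Measurable (R V))
    {F : GaugeField P j (SUN N) → ℝ≥0∞} (hF : Measurable F)
    (hFw : ∀ V y, F (updateFinset V Λ y) = windowSU Λ (c V) S y * R V y)
    (hfin : ∀ V, ((blockLaw Λ).withDensity fun y => F (updateFinset V Λ y)) univ ≠ ∞)
    {u : GaugeField P j (SUN N) → ℝ} (hu : Measurable u)
    -- level data per exterior section
    (Ttr : TraceData A) (hN : 0 < Ttr.N) {ι κ : Type*} {Pu : Finset ι} (hPu : Pu.Nonempty)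
    (hol : GaugeField P j (SUN N) → ι → BlockChartSU N Λ → A) (hcont : ∀ V, ∀ p ∈ Pu, Continuous (hol V p))
    (Pw : Finset κ) (G : GaugeField P j (SUN N) → κ → BlockChartSU N Λ → A)
    (𝓔 : GaugeField P j (SUN N) → BlockChartSU N Λ → ℝ)
    (W : GaugeField P j (SUN N) → Set (BlockChartSU N Λ)) (Jco : GaugeField P j (SUN N) → BlockChartSU N Λ → ℝ≥0∞)
    {θ δ ρ β Rad H B𝓔 : ℝ} {sw lw dw : κ → ℝ}
    -- DICTIONARY (block weight, tested variable: on the chart ball only, RAW sections)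
    (hRdict : ∀ V, ∀ x ∈ closedBall (0 : BlockChartSU N Λ) S,
      R V (expFibreChartSU Λ (c V) x) = Jco V x * weight Ttr β Pw (G V) (𝓔 V) x)
    (hudict : ∀ V, ∀ x ∈ closedBall (0 : BlockChartSU N Λ) S,
      u (updateFinset V Λ (expFibreChartSU Λ (c V) x)) = classifier hPu (hol V) x)
    -- SM-L5/L6: kept co-tests supported in the window, centre-monotone
    (hJW : ∀ V x, Jco V x ≠ 0 → x ∈ W V)
    (hJ : ∀ V x, ∀ a : ℝ, 0 ≤ a → Jco V x ≤ Jco V (Real.exp (-a) • x))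
    -- SM-L1 (AN-bound)
    (hRad : 1 < Rad)
    (hAN : ∀ V, ∀ x ∈ W V, ∀ p ∈ Pu, ∃ f : ℂ → A, DifferentiableOn ℂ f (ball 0 Rad) ∧
      (∀ w ∈ ball (0 : ℂ) Rad, ‖f w‖ ≤ H) ∧ f 0 = 0 ∧ ∀ c' : ℝ, 0 ≤ c' → c' ≤ 1 → f (c' : ℂ) = hol V p (c' • x) - 1)
    -- SM-L3 graded sectioned words
    (hGW : ∀ V, ∀ x ∈ W V, ∀ p ∈ Pw, ∃ gw : List (MLetter A × ℝ × ℝ), (∀ y ∈ gw, y.1.Good Ttr.τ y.2.1 y.2.2) ∧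
      sSum gw ≤ sw p ∧ lSum gw ≤ lw p ∧ mdFro (gw.map Prod.fst) ≤ dw p ∧
      ∀ c' : ℝ, 0 ≤ c' → c' ≤ 1 → mwordEval c' (gw.map Prod.fst) = G V p (c' • x))
    (hsw1 : ∀ p ∈ Pw, sw p ≤ 1) (hsw0 : ∀ p ∈ Pw, 0 ≤ sw p) (hlw0 : ∀ p ∈ Pw, 0 ≤ lw p)
    (hdw0 : ∀ p ∈ Pw, 0 ≤ dw p)
    -- SM-L4 non-Wilson ray bound
    (hE : ∀ V, ∀ x ∈ W V, ∀ c' : ℝ, 1 / 2 ≤ c' → c' ≤ 1 → 𝓔 V (c' • x) ≤ 𝓔 V x + (1 - c') * B𝓔) (hB𝓔 : 0 ≤ B𝓔)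
    -- numbers + SM-L2 (SM)
    (hθ : 0 < θ) (hδ0 : 0 ≤ δ) (hδ1 : δ < 1) (hρ0 : 0 ≤ ρ) (hρ : ρ ≤ (1 - δ) / 2) (hβ : 0 ≤ β)
    (hSM : 36 * H * 1 ^ 2 / (Rad - 1) ^ 2 ≤ δ * θ) :
    SlotAntiConcentration ((fieldMeasure P j (SUN N)).withDensity F) u θ ρ
      (2 * (((Λ.card * dimSU N : ℕ) : ℝ) + (β * ∑ p ∈ Pw, lw p * (dw p + 4 * sw p) + B𝓔)) / (1 - δ)) := by
  refine slotAC_realized_suN_of_chartAC Λ hS hSπ c hR hF hFw hu fun V => ?_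
  -- the chart law of the section
  have hsecF : (fun y => F (updateFinset V Λ y)) = fun y => windowSU Λ (c V) S y * R V y := funext (hFw V)
  -- the block chart weight vanishes off the ball
  have hoff : ∀ x ∉ closedBall (0 : BlockChartSU N Λ) S, chartWeightSU Λ S (expJacWeightSU (kappaSU N)) x = 0 :=
    fun x hx => by
      by_contra h
      exact hx (mem_closedBall_of_chartWeightSU_ne_zero Λ h)
  -- the density rewritten through the dictionary ON THE BALL; off the ball both sides vanish
  have hdens : (fun x : BlockChartSU N Λ =>
        chartWeightSU Λ S (expJacWeightSU (kappaSU N)) x * R V (expFibreChartSU Λ (c V) x)) =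
      fun x => (chartWeightSU Λ S (expJacWeightSU (kappaSU N)) x * Jco V x) * weight Ttr β Pw (G V) (𝓔 V) x := by
    funext x
    by_cases hx : x ∈ closedBall (0 : BlockChartSU N Λ) S
    · rw [hRdict V x hx, mul_assoc]
    · simp only [hoff x hx, zero_mul]
  rw [hdens]
  -- finiteness of the sub-threshold mass of the chart law (from the section's finite mass)
  have hfin' : ((volume : Measure (BlockChartSU N Λ)).withDensity fun x =>
      (chartWeightSU Λ S (expJacWeightSU (kappaSU N)) x * Jco V x) * weight Ttr β Pw (G V) (𝓔 V) x)
        {x | classifier hPu (hol V) x < θ} ≠ ∞ := by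
    refine ne_top_of_le_ne_top ?_ (measure_mono (subset_univ _))
    rw [← hdens, chartLaw_univ_eq Λ (c V) hS (measurable_expJacWeightSU (kappaSU N))
        (haar_restrict_expBallSU_le hSπ) (hR V), ← hsecF]
    exact hfin V
  -- the one-depth assembly on the chart, window ∩ ball as the window, chart weight × co-tests as the factor
  have h := slotAntiConcentration_of_levelData (volume : Measure (BlockChartSU N Λ)) Ttr hN hPu (hol V) (hcont V)
    Pw (G V) (𝓔 V) (W := W V ∩ closedBall (0 : BlockChartSU N Λ) S)
    (J := fun x => chartWeightSU Λ S (expJacWeightSU (kappaSU N)) x * Jco V x)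
    (fun x hx => ⟨hJW V x (right_ne_zero_of_mul hx),
      mem_closedBall_of_chartWeightSU_ne_zero Λ (left_ne_zero_of_mul hx)⟩)
    (fun x a ha => mul_le_mul' (chartWeightSU_le_smul_of_pos Λ (expJacWeightSU_le_smul (kappaSU N) hSπ) ha x)
      (hJ V x a ha)) hRad
    (fun x hx p hp => hAN V x hx.1 p hp) (fun x hx p hp => hGW V x hx.1 p hp) hsw1 hsw0 hlw0 hdw0
    (fun x hx c' h1 h2 => hE V x hx.1 c' h1 h2) hB𝓔 hθ hδ0 hδ1 hρ0 hρ hβ hSM hfin'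
  rw [finrank_blockChart] at h
  -- the tested variable is read through the dictionary ON THE BALL; off the ball the chart law vanishes
  exact slotAntiConcentration_congr_ae (ae_eq_of_eqOn_offNull volume measurableSet_closedBall
    (fun x hx => by simp only [hoff x hx, zero_mul]) (hudict V)) h

/-- **END-II FOR `G = SU(N)` THROUGH THE TREE GAUGE — REALIZED (M1) ⇐ SM-L1…L6 + DICTIONARY ON THE CHART BALL, PER
SLOT, EVERY `N`.**  E2′ `ShellMeasureRootCompositionLevelZero.slotAC_realized_su2_of_levelData_cube` word for word
with the `SU(N)` chart objects (see `slotAC_realized_suN_of_levelData_ball_raw` for the binder census): loop-free tree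
`T`, prescribed values `U₀`, GAUGE-INVARIANT measurable `F` and `u`, window factorisation / finiteness / dictionary
asked of the TREE-GAUGED sections `V ↦ (F ∘ fixTo T U₀)(V[Λ := y])`, `u ∘ fixTo T U₀`; the raw form transported by
`ShellMeasureScalingLocal.slotAntiConcentration_gaugeFixed_iff`.  CONCLUSION:
`SlotAntiConcentration ((fieldMeasure P j SU(N)).withDensity F) u θ ρ (2(#Λ·d_N + β Σ_p L̄_p(d̄_p + 4s̄_p) + B_𝓔)/(1−δ))`
— the per-slot `hac` binder of END-I for the `SU(N)` family (`ShellMeasureRootCompositionSeamTower`, `G := SUN N`).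
CONDITIONAL on every binder; nothing PRINTED is asserted. [folklore] -/
theorem slotAC_realized_suN_of_levelData_ball {T : Finset (PBond P j)} (hT : NoClosedLoop T)
    (U₀ : GaugeField P j (SUN N)) (Λ : Finset (PBond P j)) {S : ℝ} (hS : 0 ≤ S) (hSπ : S ≤ Real.pi)
    (c : GaugeField P j (SUN N) → GaugeField P j (SUN N))
    {R : GaugeField P j (SUN N) → (↥Λ → SUN N) → ℝ≥0∞} (hR : ∀ V, Measurable (R V))
    {F : GaugeField P j (SUN N) → ℝ≥0∞} (hF : Measurable F) (hFi : GaugeInvariant F)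
    (hFw : ∀ V y, F (fixTo T U₀ (updateFinset V Λ y)) = windowSU Λ (c V) S y * R V y)
    (hfin : ∀ V, ((blockLaw Λ).withDensity fun y => F (fixTo T U₀ (updateFinset V Λ y))) univ ≠ ∞)
    {u : GaugeField P j (SUN N) → ℝ} (hu : Measurable u) (hui : GaugeInvariant u)
    -- level data per exterior section
    (Ttr : TraceData A) (hN : 0 < Ttr.N) {ι κ : Type*} {Pu : Finset ι} (hPu : Pu.Nonempty)
    (hol : GaugeField P j (SUN N) → ι → BlockChartSU N Λ → A) (hcont : ∀ V, ∀ p ∈ Pu, Continuous (hol V p))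
    (Pw : Finset κ) (G : GaugeField P j (SUN N) → κ → BlockChartSU N Λ → A)
    (𝓔 : GaugeField P j (SUN N) → BlockChartSU N Λ → ℝ)
    (W : GaugeField P j (SUN N) → Set (BlockChartSU N Λ)) (Jco : GaugeField P j (SUN N) → BlockChartSU N Λ → ℝ≥0∞)
    {θ δ ρ β Rad H B𝓔 : ℝ} {sw lw dw : κ → ℝ}
    -- DICTIONARY (block weight, tested variable: on the chart ball only, TREE-GAUGED sections)
    (hRdict : ∀ V, ∀ x ∈ closedBall (0 : BlockChartSU N Λ) S,
      R V (expFibreChartSU Λ (c V) x) = Jco V x * weight Ttr β Pw (G V) (𝓔 V) x)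
    (hudict : ∀ V, ∀ x ∈ closedBall (0 : BlockChartSU N Λ) S,
      u (fixTo T U₀ (updateFinset V Λ (expFibreChartSU Λ (c V) x))) = classifier hPu (hol V) x)
    -- SM-L5/L6: kept co-tests supported in the window, centre-monotone
    (hJW : ∀ V x, Jco V x ≠ 0 → x ∈ W V)
    (hJ : ∀ V x, ∀ a : ℝ, 0 ≤ a → Jco V x ≤ Jco V (Real.exp (-a) • x))
    -- SM-L1 (AN-bound)
    (hRad : 1 < Rad)
    (hAN : ∀ V, ∀ x ∈ W V, ∀ p ∈ Pu, ∃ f : ℂ → A, DifferentiableOn ℂ f (ball 0 Rad) ∧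
      (∀ w ∈ ball (0 : ℂ) Rad, ‖f w‖ ≤ H) ∧ f 0 = 0 ∧ ∀ c' : ℝ, 0 ≤ c' → c' ≤ 1 → f (c' : ℂ) = hol V p (c' • x) - 1)
    -- SM-L3 graded sectioned words
    (hGW : ∀ V, ∀ x ∈ W V, ∀ p ∈ Pw, ∃ gw : List (MLetter A × ℝ × ℝ), (∀ y ∈ gw, y.1.Good Ttr.τ y.2.1 y.2.2) ∧
      sSum gw ≤ sw p ∧ lSum gw ≤ lw p ∧ mdFro (gw.map Prod.fst) ≤ dw p ∧
      ∀ c' : ℝ, 0 ≤ c' → c' ≤ 1 → mwordEval c' (gw.map Prod.fst) = G V p (c' • x))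
    (hsw1 : ∀ p ∈ Pw, sw p ≤ 1) (hsw0 : ∀ p ∈ Pw, 0 ≤ sw p) (hlw0 : ∀ p ∈ Pw, 0 ≤ lw p)
    (hdw0 : ∀ p ∈ Pw, 0 ≤ dw p)
    -- SM-L4 non-Wilson ray bound
    (hE : ∀ V, ∀ x ∈ W V, ∀ c' : ℝ, 1 / 2 ≤ c' → c' ≤ 1 → 𝓔 V (c' • x) ≤ 𝓔 V x + (1 - c') * B𝓔) (hB𝓔 : 0 ≤ B𝓔)
    -- numbers + SM-L2 (SM)
    (hθ : 0 < θ) (hδ0 : 0 ≤ δ) (hδ1 : δ < 1) (hρ0 : 0 ≤ ρ) (hρ : ρ ≤ (1 - δ) / 2) (hβ : 0 ≤ β)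
    (hSM : 36 * H * 1 ^ 2 / (Rad - 1) ^ 2 ≤ δ * θ) :
    SlotAntiConcentration ((fieldMeasure P j (SUN N)).withDensity F) u θ ρ
      (2 * (((Λ.card * dimSU N : ℕ) : ℝ) + (β * ∑ p ∈ Pw, lw p * (dw p + 4 * sw p) + B𝓔)) / (1 - δ)) :=
  (slotAntiConcentration_gaugeFixed_iff hT U₀ hF hFi hu hui).1
    (slotAC_realized_suN_of_levelData_ball_raw Λ hS hSπ c hR (hF.comp (measurable_fixTo T U₀)) hFw hfin
      (hu.comp (measurable_fixTo T U₀)) Ttr hN hPu hol hcont Pw G 𝓔 W Jco hRdict hudict hJW hJ hRad hAN hGW hsw1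
      hsw0 hlw0 hdw0 hE hB𝓔 hθ hδ0 hδ1 hρ0 hρ hβ hSM)

end EndTwo

end Summit.QuantumFields.BalabanUV.T4Continuum.ShellMeasureRootCompositionSUN

end
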